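import Literature.AnabelianGeometry.EtaleTheta.BiKummerThm44SubModelConnectedOfGaloisCoveringCosetFull
import Literature.AnabelianGeometry.EtaleTheta.BiKummerThm44SubNHSatDef22Conj

/-!
# [EtTh] Theorem 4.4 — up to IN FULL — over the constructed Def 3.3 (iii) data on the small COSET model of `D₀`, with
# T44-L15b at the FAITHFUL [FrdII] Def 2.2 (ii) reading, context isomorphisms plain OR up to inner automorphism
# (proof-only)

S. Mochizuki, *The étale theta function …*, Publ. RIMS **45** (2009) [MochizukiEtTh2009], §4, Thm 4.4 (i)–(iii) PDF p.94,
proof p.95 ll.14–16 («cf. [FrdII], Definition 2.2, (ii); [AbsAnab], Lemma 1.3.8»); S. Mochizuki, *The geometry of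
Frobenioids II* (2008) [MochizukiFrdII2008], Def 2.2 (i) («outer homomorphism»), (ii) p.17, Thm 2.4 (i) p.19.  abc-iut
cell, layer L2, plan/L2/SUBDAG-EtTh-Thm44.md (custodian lineage abc-iut-w5-d179), cone nodes `EtTh:Thm4.4(i)(ii)(iii)`, rows
T44-L15b / T44-L16.  Seat abc-iut-w5-d179 (gen 5).  PROOF-ONLY (0 `def`s, no `Prop` facts, no instances); consumed BY NAME:
abc-iut-w6-d047's `Thm44Hyp.preservesNHSaturatedBsFld_of_def22Iso` (p438298) and its relaxation
`…_of_def22Iso_conjOuter` (p445405: the context isomorphisms may be taken after re-choosing the representatives of the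
outer homomorphisms `G_{K_i} ↠ G_{A_i}`), this lineage's coset-model closers (p443031 / p443606).  The connected-model twin of
the plain form is `BiKummerThm44SubModelConnectedOfGaloisCoveringDef22.lean` (p439679); the coset model had no Def 2.2 file.

WHAT THIS FILE PROVES (weak `Λ = ℤ` data of the coset model `DivisorMonoids.ofGaloisActionCoset A hZ`, base field
`K : Type u`; slots `NH_i` READ [FrdII] Def 2.2 (ii) through context assignments `ctx_i` — hypotheses `hNH_i`):
* `…_ofGaloisActionCoset_treeVocabWeak_of_def22Iso` — Thm 4.4 (i) ∧ (ii) ∧ (iii) ∧ roots ⇐ {`hIso`};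
* `…_of_def22IsoConj` — the same ⇐ {`hIsoConj`} (context isomorphisms UP TO INNER AUTOMORPHISM — all that [FrdI] Thm 3.4 (v)
  / [SemiAnbd] Prop 3.2 / [AbsAnab] Lem 1.3.8 supply);
* (`u = 0`) `thm44_full_…_ofGaloisActionCoset_treeVocabWeak_of_def22IsoConj` — **[EtTh] Thm 4.4 (i) ∧ (ii) ∧ (iii) IN FULL
  (saturation ∧ Kummer class) ∧ roots at the faithful reading ⇐ {`hNH₁`, `hNH₂`, `hIsoConj`} — no structural binder, no
  constructor parameter, no plan/FACT-LIST fact.**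
NV: the quantified class of tempered Frobenioids over the coset data is INHABITED (`OneCompCoset.nonempty_…`, p446238).
HONEST FRAMING: refereed pre-IUT material; every theorem is an implication for data so parametrised (`LogDivisorModel` /
`GaloisAction` / `CuspLaws` / the Def 2.2 context assignments are interface and parameter records); one term of the Def 3.3
(iii) limit (Rmk 3.3.1); nothing here bears on the disputed [IUTchIII] Cor. 3.12; typed ≠ proved — here PROVED.
-/

noncomputable section

namespace Literature.AnabelianGeometry.EtaleTheta

open CategoryTheory Opposite Function Literature.AlgebraicGeometry.Frobenioids Literature.AnabelianGeometry.SemiGraphs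

universe u

namespace BiKummerSetting

open LogDivisorModel.GaloisAction

/-! ### §1 Weak coset data, faithful Def 2.2 (ii) reading: Thm 4.4 (i)(ii)(iii)+roots -/

section WeakDef22

variable {Z₁ : LogDivisorModel.{u}} {G₁ : Type u} [Group G₁] (GA₁ : Z₁.GaloisAction G₁) (hC₁ : Z₁.CuspLaws)
  {Z₂ : LogDivisorModel.{u}} {G₂ : Type u} [Group G₂] (GA₂ : Z₂.GaloisAction G₂) (hC₂ : Z₂.CuspLaws)
  {K : Type u} [Field K] {K' : Type u} [Field K'] {X₁ : SemiGraphs.TemperedArithmeticGroup.{u} K}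
  {X₂ : SemiGraphs.TemperedArithmeticGroup.{u} K'}
  {IsRational₁ IsStrictlyRational₁ : ((ConnectedPart (BTemp X₁.Pi))ᵒᵖ ⥤ CommMonCat.{u}) → Prop}
  {IsRational₂ IsStrictlyRational₂ : ((ConnectedPart (BTemp X₂.Pi))ᵒᵖ ⥤ CommMonCat.{u}) → Prop}

/-- **[EtTh] Thm 4.4 (i) ∧ (ii) ∧ (iii) ∧ (`N`-th roots) at `B^temp(Π^tp_X)⁰` over the WEAK coset data, T44-L15b AT THE
FAITHFUL [FrdII] Def 2.2 (ii) READING ⇐ {`hIso`}** (beyond the reading `hNH_i`): p443031's closer with T44-L15b supplied by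
abc-iut-w6-d047's `preservesNHSaturatedBsFld_of_def22Iso`. [cite: MochizukiEtTh2009, Thm 4.4 p.94] -/
theorem Thm44Hyp.thm44_mkOfConnectedTemperoid_ofGaloisActionCoset_treeVocabWeak_of_def22Iso
    {tf₁ : TemperedFrobenioid
      (RealifiedDivisorMonoids.ofRlfZWeak (DivisorMonoids.ofGaloisActionCoset GA₁ hC₁)
        (DivisorMonoids.ofGaloisActionCoset_isPerfFactorialCof GA₁ hC₁))
      (ConnectedPart (BTemp X₁.Pi)) (treeCatVocab (ConnectedPart (BTemp X₁.Pi)) IsRational₁ IsStrictlyRational₁)}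
    {hZ₁ : tf₁.monoidType = MonoidType.Z} {hP₁ : ∀ A : (ConnectedPart (BTemp X₁.Pi))ᵒᵖ, IsPerfect (tf₁.Φ.carrier A)}
    {NH₁ : Subgroup (Field.absoluteGaloisGroup K) → tf₁.category → ℕ+ → Prop} {A₁ : tf₁.category}
    {hA₁ : PreFrobenioid.IsFrobeniusTrivial tf₁.toElem A₁} {hA₁' : SemiGraphs.IsGaloisObj A₁.base.obj}
    {tf₂ : TemperedFrobenioid
      (RealifiedDivisorMonoids.ofRlfZWeak (DivisorMonoids.ofGaloisActionCoset GA₂ hC₂)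
        (DivisorMonoids.ofGaloisActionCoset_isPerfFactorialCof GA₂ hC₂))
      (ConnectedPart (BTemp X₂.Pi)) (treeCatVocab (ConnectedPart (BTemp X₂.Pi)) IsRational₂ IsStrictlyRational₂)}
    {hZ₂ : tf₂.monoidType = MonoidType.Z} {hP₂ : ∀ B : (ConnectedPart (BTemp X₂.Pi))ᵒᵖ, IsPerfect (tf₂.Φ.carrier B)}
    {NH₂ : Subgroup (Field.absoluteGaloisGroup K') → tf₂.category → ℕ+ → Prop} {A₂ : tf₂.category}
    {hA₂ : PreFrobenioid.IsFrobeniusTrivial tf₂.toElem A₂} {hA₂' : SemiGraphs.IsGaloisObj A₂.base.obj}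
    (h : Thm44Hyp (mkOfConnectedTemperoid X₁ tf₁ hZ₁ hP₁ NH₁ A₁ hA₁ hA₁')
      (mkOfConnectedTemperoid X₂ tf₂ hZ₂ hP₂ NH₂ A₂ hA₂ hA₂'))
    (hF₁ : PreFrobenioid.IsFrobenioid tf₁.toElem) (hF₂ : PreFrobenioid.IsFrobenioid tf₂.toElem)
    (h3 : h.PreservesFrobeniusStructure)
    (ctx₁ : tf₁.category → PadicKummer.Def22Context) (ctx₂ : tf₂.category → PadicKummer.Def22Context)
    (hNH₁ : ∀ (A : tf₁.category) (N : ℕ+),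
      NH₁ (mkOfConnectedTemperoid X₁ tf₁ hZ₁ hP₁ NH₁ A₁ hA₁ hA₁').HodotBsFld A N ↔ PadicKummer.IsNHSaturated (ctx₁ A) N)
    (hNH₂ : ∀ (B : tf₂.category) (N : ℕ+),
      NH₂ (mkOfConnectedTemperoid X₂ tf₂ hZ₂ hP₂ NH₂ A₂ hA₂ hA₂').HodotBsFld B N ↔ PadicKummer.IsNHSaturated (ctx₂ B) N)
    (hIso : ∀ (A'' : tf₁.category) (B'' : tf₂.category), PreFrobenioid.IsFrobeniusTrivial tf₁.toElem A'' →
      (h.Ψ.functor.obj A'' ≅ B'') → Nonempty (PadicKummer.Def22Context.Iso (ctx₁ A'') (ctx₂ B''))) :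
    Thm44_i (V := treeMonoidVocabWeak.{u}) h ∧ Thm44_ii h (h.psiModel hF₁ hF₂ h3) ∧
      Thm44_iii h (h.psiModel hF₁ hF₂ h3) ∧
      h.PreservesNthRoots (h.psiModel hF₁ hF₂ h3) (fun φ f => tf₁.pullFracModel φ f)
        (fun φ f => tf₂.pullFracModel φ f) :=
  h.thm44_mkOfConnectedTemperoid_ofGaloisActionCoset_treeVocabWeak GA₁ hC₁ GA₂ hC₂ hF₁ hF₂ h3
    (h.preservesNHSaturatedBsFld_of_def22Iso ctx₁ ctx₂ hNH₁ hNH₂ hIso)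

/-- **The same with the context isomorphisms only UP TO INNER AUTOMORPHISM** (`hIsoConj`: after re-choosing the
representatives of the outer homomorphisms `G_{K_i} ↠ G_{A_i}`, [FrdII] Def 2.2 (i)) — abc-iut-w6-d047's relaxation
`preservesNHSaturatedBsFld_of_def22Iso_conjOuter` (p445405). [cite: MochizukiEtTh2009, Thm 4.4 p.94] -/
theorem Thm44Hyp.thm44_mkOfConnectedTemperoid_ofGaloisActionCoset_treeVocabWeak_of_def22IsoConj
    {tf₁ : TemperedFrobenioid
      (RealifiedDivisorMonoids.ofRlfZWeak (DivisorMonoids.ofGaloisActionCoset GA₁ hC₁)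
        (DivisorMonoids.ofGaloisActionCoset_isPerfFactorialCof GA₁ hC₁))
      (ConnectedPart (BTemp X₁.Pi)) (treeCatVocab (ConnectedPart (BTemp X₁.Pi)) IsRational₁ IsStrictlyRational₁)}
    {hZ₁ : tf₁.monoidType = MonoidType.Z} {hP₁ : ∀ A : (ConnectedPart (BTemp X₁.Pi))ᵒᵖ, IsPerfect (tf₁.Φ.carrier A)}
    {NH₁ : Subgroup (Field.absoluteGaloisGroup K) → tf₁.category → ℕ+ → Prop} {A₁ : tf₁.category}
    {hA₁ : PreFrobenioid.IsFrobeniusTrivial tf₁.toElem A₁} {hA₁' : SemiGraphs.IsGaloisObj A₁.base.obj}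
    {tf₂ : TemperedFrobenioid
      (RealifiedDivisorMonoids.ofRlfZWeak (DivisorMonoids.ofGaloisActionCoset GA₂ hC₂)
        (DivisorMonoids.ofGaloisActionCoset_isPerfFactorialCof GA₂ hC₂))
      (ConnectedPart (BTemp X₂.Pi)) (treeCatVocab (ConnectedPart (BTemp X₂.Pi)) IsRational₂ IsStrictlyRational₂)}
    {hZ₂ : tf₂.monoidType = MonoidType.Z} {hP₂ : ∀ B : (ConnectedPart (BTemp X₂.Pi))ᵒᵖ, IsPerfect (tf₂.Φ.carrier B)}
    {NH₂ : Subgroup (Field.absoluteGaloisGroup K') → tf₂.category → ℕ+ → Prop} {A₂ : tf₂.category}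
    {hA₂ : PreFrobenioid.IsFrobeniusTrivial tf₂.toElem A₂} {hA₂' : SemiGraphs.IsGaloisObj A₂.base.obj}
    (h : Thm44Hyp (mkOfConnectedTemperoid X₁ tf₁ hZ₁ hP₁ NH₁ A₁ hA₁ hA₁')
      (mkOfConnectedTemperoid X₂ tf₂ hZ₂ hP₂ NH₂ A₂ hA₂ hA₂'))
    (hF₁ : PreFrobenioid.IsFrobenioid tf₁.toElem) (hF₂ : PreFrobenioid.IsFrobenioid tf₂.toElem)
    (h3 : h.PreservesFrobeniusStructure)
    (ctx₁ : tf₁.category → PadicKummer.Def22Context) (ctx₂ : tf₂.category → PadicKummer.Def22Context)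
    (hNH₁ : ∀ (A : tf₁.category) (N : ℕ+),
      NH₁ (mkOfConnectedTemperoid X₁ tf₁ hZ₁ hP₁ NH₁ A₁ hA₁ hA₁').HodotBsFld A N ↔ PadicKummer.IsNHSaturated (ctx₁ A) N)
    (hNH₂ : ∀ (B : tf₂.category) (N : ℕ+),
      NH₂ (mkOfConnectedTemperoid X₂ tf₂ hZ₂ hP₂ NH₂ A₂ hA₂ hA₂').HodotBsFld B N ↔ PadicKummer.IsNHSaturated (ctx₂ B) N)
    (hIsoConj : ∀ (A'' : tf₁.category) (B'' : tf₂.category), PreFrobenioid.IsFrobeniusTrivial tf₁.toElem A'' →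
      (h.Ψ.functor.obj A'' ≅ B'') → ∃ (g₁ : (ctx₁ A'').G) (g₂ : (ctx₂ B'').G),
        Nonempty (PadicKummer.Def22Context.Iso ((ctx₁ A'').conjOuter g₁) ((ctx₂ B'').conjOuter g₂))) :
    Thm44_i (V := treeMonoidVocabWeak.{u}) h ∧ Thm44_ii h (h.psiModel hF₁ hF₂ h3) ∧
      Thm44_iii h (h.psiModel hF₁ hF₂ h3) ∧
      h.PreservesNthRoots (h.psiModel hF₁ hF₂ h3) (fun φ f => tf₁.pullFracModel φ f)
        (fun φ f => tf₂.pullFracModel φ f) :=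
  h.thm44_mkOfConnectedTemperoid_ofGaloisActionCoset_treeVocabWeak GA₁ hC₁ GA₂ hC₂ hF₁ hF₂ h3
    (h.preservesNHSaturatedBsFld_of_def22Iso_conjOuter ctx₁ ctx₂ hNH₁ hNH₂ hIsoConj)

end WeakDef22

/-! ### §2 Weak coset data, universe `0`: [EtTh] Thm 4.4 IN FULL at the faithful reading -/

section FullWeakDef22

variable {Z₁ : LogDivisorModel.{0}} {G₁ : Type} [Group G₁] (GA₁ : Z₁.GaloisAction G₁) (hC₁ : Z₁.CuspLaws)
  {Z₂ : LogDivisorModel.{0}} {G₂ : Type} [Group G₂] (GA₂ : Z₂.GaloisAction G₂) (hC₂ : Z₂.CuspLaws)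
  {K : Type} [Field K] {K' : Type} [Field K'] {X₁ : SemiGraphs.TemperedArithmeticGroup.{0} K}
  {X₂ : SemiGraphs.TemperedArithmeticGroup.{0} K'}
  {IsRational₁ IsStrictlyRational₁ : ((ConnectedPart (BTemp X₁.Pi))ᵒᵖ ⥤ CommMonCat.{0}) → Prop}
  {IsRational₂ IsStrictlyRational₂ : ((ConnectedPart (BTemp X₂.Pi))ᵒᵖ ⥤ CommMonCat.{0}) → Prop}

/-- **[EtTh] Theorem 4.4 (i) ∧ (ii) ∧ (iii) IN FULL (saturation ∧ Kummer class) ∧ (`N`-th roots) at `B^temp(Π^tp_X)⁰`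
over the WEAK coset data, T44-L15b AT THE FAITHFUL [FrdII] Def 2.2 (ii) READING with context isomorphisms UP TO INNER
AUTOMORPHISM ⇐ {`hNH₁`, `hNH₂` (the reading), `hIsoConj`} — no structural binder, no constructor parameter, no
plan/FACT-LIST fact** (p443606 §4 with T44-L15b := abc-iut-w6-d047's `preservesNHSaturatedBsFld_of_def22Iso_conjOuter`).
[cite: MochizukiEtTh2009, Thm 4.4 p.94] -/
theorem Thm44Hyp.thm44_full_mkOfConnectedTemperoid_ofGaloisActionCoset_treeVocabWeak_of_def22IsoConj
    {tf₁ : TemperedFrobenioid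
      (RealifiedDivisorMonoids.ofRlfZWeak (DivisorMonoids.ofGaloisActionCoset GA₁ hC₁)
        (DivisorMonoids.ofGaloisActionCoset_isPerfFactorialCof GA₁ hC₁))
      (ConnectedPart (BTemp X₁.Pi)) (treeCatVocab (ConnectedPart (BTemp X₁.Pi)) IsRational₁ IsStrictlyRational₁)}
    {hZ₁ : tf₁.monoidType = MonoidType.Z} {hP₁ : ∀ A : (ConnectedPart (BTemp X₁.Pi))ᵒᵖ, IsPerfect (tf₁.Φ.carrier A)}
    {NH₁ : Subgroup (Field.absoluteGaloisGroup K) → tf₁.category → ℕ+ → Prop} {A₁ : tf₁.category}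
    {hA₁ : PreFrobenioid.IsFrobeniusTrivial tf₁.toElem A₁} {hA₁' : SemiGraphs.IsGaloisObj A₁.base.obj}
    {tf₂ : TemperedFrobenioid
      (RealifiedDivisorMonoids.ofRlfZWeak (DivisorMonoids.ofGaloisActionCoset GA₂ hC₂)
        (DivisorMonoids.ofGaloisActionCoset_isPerfFactorialCof GA₂ hC₂))
      (ConnectedPart (BTemp X₂.Pi)) (treeCatVocab (ConnectedPart (BTemp X₂.Pi)) IsRational₂ IsStrictlyRational₂)}
    {hZ₂ : tf₂.monoidType = MonoidType.Z} {hP₂ : ∀ B : (ConnectedPart (BTemp X₂.Pi))ᵒᵖ, IsPerfect (tf₂.Φ.carrier B)}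
    {NH₂ : Subgroup (Field.absoluteGaloisGroup K') → tf₂.category → ℕ+ → Prop} {A₂ : tf₂.category}
    {hA₂ : PreFrobenioid.IsFrobeniusTrivial tf₂.toElem A₂} {hA₂' : SemiGraphs.IsGaloisObj A₂.base.obj}
    (h : Thm44Hyp (mkOfConnectedTemperoid X₁ tf₁ hZ₁ hP₁ NH₁ A₁ hA₁ hA₁')
      (mkOfConnectedTemperoid X₂ tf₂ hZ₂ hP₂ NH₂ A₂ hA₂ hA₂'))
    (hF₁ : PreFrobenioid.IsFrobenioid tf₁.toElem) (hF₂ : PreFrobenioid.IsFrobenioid tf₂.toElem)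
    (h3 : Thm44Hyp.PreservesFrobeniusStructure (V := treeMonoidVocabWeak.{0}) h)
    (ctx₁ : tf₁.category → PadicKummer.Def22Context) (ctx₂ : tf₂.category → PadicKummer.Def22Context)
    (hNH₁ : ∀ (A : tf₁.category) (N : ℕ+),
      NH₁ (mkOfConnectedTemperoid X₁ tf₁ hZ₁ hP₁ NH₁ A₁ hA₁ hA₁').HodotBsFld A N ↔ PadicKummer.IsNHSaturated (ctx₁ A) N)
    (hNH₂ : ∀ (B : tf₂.category) (N : ℕ+),
      NH₂ (mkOfConnectedTemperoid X₂ tf₂ hZ₂ hP₂ NH₂ A₂ hA₂ hA₂').HodotBsFld B N ↔ PadicKummer.IsNHSaturated (ctx₂ B) N)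
    (hIsoConj : ∀ (A'' : tf₁.category) (B'' : tf₂.category), PreFrobenioid.IsFrobeniusTrivial tf₁.toElem A'' →
      (h.Ψ.functor.obj A'' ≅ B'') → ∃ (g₁ : (ctx₁ A'').G) (g₂ : (ctx₂ B'').G),
        Nonempty (PadicKummer.Def22Context.Iso ((ctx₁ A'').conjOuter g₁) ((ctx₂ B'').conjOuter g₂))) :
    Thm44_i h ∧ Thm44_ii h (h.psiModel hF₁ hF₂ h3) ∧ Thm44_iii h (h.psiModel hF₁ hF₂ h3) ∧
      h.PreservesKummerClass (h.psiModel hF₁ hF₂ h3)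
        (h.galoisCompatible_mkOfConnectedTemperoid _ _ _ _ _ _ _ _ _ _ _ _ _ _)
        (h.biratCompatible_mkOfModel hF₁ hF₂ h3) ∧
      h.PreservesNthRoots (h.psiModel hF₁ hF₂ h3) (fun φ f => tf₁.pullFracModel φ f)
        (fun φ f => tf₂.pullFracModel φ f) :=
  h.thm44_full_mkOfConnectedTemperoid_ofGaloisActionCoset_treeVocabWeak GA₁ hC₁ GA₂ hC₂ hF₁ hF₂ h3
    (h.preservesNHSaturatedBsFld_of_def22Iso_conjOuter ctx₁ ctx₂ hNH₁ hNH₂ hIsoConj)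

end FullWeakDef22

end BiKummerSetting

end Literature.AnabelianGeometry.EtaleTheta

end
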